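import Literature.MathematicalPhysics.QuantumFieldTheory.Balaban1983to89.B8Prop5JoinSectE
import Literature.MathematicalPhysics.QuantumFieldTheory.Balaban1983to89.B8SectEKLevelPer

/-!
# `Balaban1983to89.B8Prop5JoinSectEPer` — [Balaban1985RegularSpaces] Sect. E pp. 95–97 ON THE TORUS (§3 p. 98): the map `λ ↦ D′(u₁⁻¹, −iλ)`
# on the PERIODIC configurations of the ¼α₄-ball, chosen once, with `Q′H′ = I` read at periodic families only
# (sub-row «G-B8-T2S», RULING #4 v3, layer 3(e) of `lit-balaban-t2s-1/g2/V3-DESIGN.md`)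

statement-level skeleton of published theorems with citation tags; proofs where landed; nothing here is a claim about the
Yang–Mills mass gap

T. Bałaban, *Spaces of regular gauge field configurations on a lattice and gauge fixing conditions*, Commun. Math. Phys. **99** (1985) 75–102
`[Balaban1985RegularSpaces]` ("B8"): (1.113)–(1.125) pp. 95–97, (1.91) p. 91, (1.105)–(1.106) p. 94, §3 p. 98.  STATUS: published, refereed.

CITATION HEADER (lean-in-tree rule).  Cell `lit-balaban`, seat `lit-balaban-t2s-1` (gen 2).  WHAT IS PROVED (0 sorry, no `def`).
★ `sectE_exists_per`, ★ `exists_Dprime_map_per` — `B8Prop5JoinSectE.sectE_exists ∕ exists_Dprime_map` VERBATIM except (RULING #4): `hQH`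
(`Q′H′ = I` on `𝔅_k`, (1.91)) is assumed for level-PERIODIC families only; the torus data (`Lʲ ∣ P`, shift-invariant `Λ_j`, periodic `U₀`, `u₁`,
`H′` periodic-valued on periodic `X`) are displayed; every clause of `exists_Dprime_map` is stated for PERIODIC `λ_s` (`λ_s`, `λ_t`) only, and the
solution `D′(λ_s)` is level-periodic there (`B8SectEKLevelPer.exists_Dprime_kLevel_inv_of_axial_per`).  The Lipschitz and reality clauses are
`B8Prop5JoinSectE.sectE_lipschitz ∕ sectE_real` by name (they do not use `Q′H′ = I`).

HONEST SCOPE.  Verbatim re-threads; Sect. E's contraction is n04-b/n05-b's by name; [4] ∕ [3] Prop. 10 NOT proved (displayed hypotheses);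
count-neutral; N05 ∕ `stub_PV3A` NOT discharged; nothing continuum ∕ ℝ⁴ ∕ OS ∕ mass-gap ∕ Clay — the Yang–Mills mass gap is NOT proved.  No
`sorry`, no `def`, no `… : Prop` fact, no `instance`, no `notation`.
-/

noncomputable section

open NormedSpace Metric Set Filter Topology Finset
open Complex (I)
open scoped BigOperators

namespace Literature.MathematicalPhysics.QuantumFieldTheory.Balaban1983to89.B8Prop5JoinSectEPer

open B7Prop1Explicit (e U1 expUnit val_inv_expUnit)
open B7Prop2Explicit (unitaryUnits mem_unitaryUnits unitaryUnits_le_U1 avgClosed_unitaryUnits AvgClosed C0 c2')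
open B7Prop1Local (InBox pdevOn)
open B7Prop3Flat (expCfg c3)
open B7Eq78Linearization (conjR zdBlocking QprimeIter QprimeIter_smul)
open B7Eq170Flat (cj cj_apply)
open B7Prop10General (C6 C4G)
open B7Prop10Flat (one_le_C5 C4'_nonneg C5'_nonneg)
open B7Prop9Flat (C5')
open B8Ineq130 (tlo thi)
open B7Eq92Concrete (mgauge)
open B8Eq119TwistedAxial (bgT InAx Restr129)
open B8Eq178Averages (util178 Qnl Cond179)
open B8Eq1123Concrete (Cnl cj_smul_complex)
open B8Ineq125Concrete (C2p C2p_nonneg)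
open B8Eq1117Concrete (XSpace)
open B8SectEKLevelPer (exists_Dprime_kLevel_inv_of_axial_per)
open B8Ineq132 (covDerivFwd covDeriv norm_conjR)
open B8LambdaSpaceKLevel (wt wt_pos wt_nonneg lamSubK lamOf lamOf_sub norm_lamOf_le)
open B8Prop5JoinSectE (ball_sub_119 hH1_tower sectE_lipschitz sectE_real)

-- `Site` alone could resolve to the torus sites of `Setup.lean`; re-export the `ℤ^d` sites of `B7Prop1Explicit`.
export B7Prop1Explicit (Site)

variable {d : ℕ} {𝔸 : Type*} [CStarAlgebra 𝔸] [Nontrivial 𝔸]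

section SectE

variable {L k : ℕ} {η : ℝ} {Λs : ℕ → Set (Site d)} {Eb : ℕ → Set (Site d × Fin d)} {U₀ : Site d → Fin d → 𝔸ˣ}
  {B : Site d → Fin d → 𝔸} {u₁ : Site d → 𝔸ˣ} {α₀ αP α₄ c B₀' : ℝ}

/-- ★ **`D′(u₁⁻¹, −iλ_s)` EXISTS AT A PERIODIC `λ_s` OF THE ¼α₄-BALL, IS PERIODIC, AND SATISFIES (1.114)** — `B8Prop5JoinSectE.sectE_exists` VERBATIM
with `hQH` at level-periodic families only and the torus data. [cite: Balaban1985RegularSpaces, (1.113)–(1.121) pp.95–97, (1.91) p.91, §3 p.98] -/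
theorem sectE_exists_per (hL : 2 ≤ L) (hη : 0 < η) (hU₀ : ∀ x κ, U₀ x κ ∈ unitaryUnits 𝔸) (H' : XSpace d k 𝔸 →ₗ[ℂ] (Site d → 𝔸))
    (hα : 0 < α₀) (hα3 : C0 d * α₀ ≤ 1 / 3) (hα4 : 4 * α₀ ≤ c2' d L) (hc : 0 ≤ c) (hα₄ : 0 < α₄) (hB : 0 < B₀')
    (h33 : ∀ j, j ≤ k → ∀ y ∈ Λs j, pdevOn (tlo L y j) (thi L y j) U₀ < α₀ * (((L : ℝ) ^ j)⁻¹) ^ 2)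
    (h69 : ∀ j, j ≤ k → ∀ y ∈ Λs j, ∀ (x : Site d) (κ : Fin d), InBox (tlo L y j) (thi L y j) x →
      InBox (tlo L y j) (thi L y j) (x + e κ) → ‖B x κ‖ ≤ c * ((L : ℝ) ^ j)⁻¹)
    (hd : 1 ≤ d) (hαP : 0 < αP) (hαP3 : C0 d * αP ≤ 1 / 3) (hαP2 : 2 * αP ≤ c2' d L)
    (hBu : ∀ (x : Site d) (κ : Fin d), expCfg B x κ ∈ unitaryUnits 𝔸)
    (hP : ∀ j, j ≤ k → ∀ y ∈ Λs j, pdevOn (tlo L y j) (thi L y j) (expCfg B * U₀) < αP * (((L : ℝ) ^ j)⁻¹) ^ 2)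
    (hAx : InAx L k Λs U₀ (mgauge U₀ u₁ (expCfg B) * U₀)) (h129 : Restr129 L k Λs U₀ u₁)
    (hEbT : ∀ j, j ≤ k → ∀ y ∈ Λs j, ∀ (x : Site d) (κ : Fin d), InBox (tlo L y j) (thi L y j) x →
      InBox (tlo L y j) (thi L y j) (x + e κ) → (x, κ) ∈ Eb j)
    (hH0 : ∀ (X : XSpace d k 𝔸) (x : Site d), ‖H' X x‖ ≤ B₀' * ‖X‖)
    (hH1 : ∀ j, j ≤ k → ∀ (X : XSpace d k 𝔸), ∀ p ∈ Eb j, wt L η j * ‖covDerivFwd η U₀ p.2 (H' X) p.1‖ ≤ B₀' * ‖X‖)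
    -- the torus: period `P` divisible by every `Lʲ`, shift-invariant `Λ_j`, periodic `U₀`, `u₁`, periodicity-preserving `H′`
    (P : ℤ) (hdiv : ∀ j, j ≤ k → ((L : ℤ) ^ j ∣ P))
    (hΛ : ∀ j, j ≤ k → ∀ (y : Site d) (i : Fin d), y + (P / (L : ℤ) ^ j) • e i ∈ Λs j ↔ y ∈ Λs j)
    (hU₀per : ∀ (z : Site d) (i : Fin d), U₀ (z + P • e i) = U₀ z) (hu₁per : ∀ (z : Site d) (i : Fin d), u₁ (z + P • e i) = u₁ z)
    (hHper : ∀ X : XSpace d k 𝔸, (∀ (p : Fin (k + 1) × Site d) (i : Fin d), X (p.1, p.2 + (P / (L : ℤ) ^ (p.1 : ℕ)) • e i) = X p) →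
      ∀ (z : Site d) (i : Fin d), H' X (z + P • e i) = H' X z)
    (hQH : ∀ (Y : XSpace d k 𝔸), (∀ (p : Fin (k + 1) × Site d) (i : Fin d), Y (p.1, p.2 + (P / (L : ℤ) ^ (p.1 : ℕ)) • e i) = Y p) →
      ∀ (j : ℕ) (hj : j ≤ k) (y : Site d), y ∈ Λs j →
      QprimeIter (zdBlocking d L) (bgT L U₀) j (H' Y) y = Y (⟨j, Nat.lt_succ_of_le hj⟩, y))
    (hsmall : Real.exp (4 * (800 * ((d : ℝ) + 1) ^ 2 * ((d : ℝ) + 4)) * α₀) * (1 + 8 * (131072 * ((d : ℝ) + 1) ^ 2) * c) ≤ 2)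
    (hc₃ : 2 * c ≤ c3 d L) (hsc : 2048 * (d : ℝ) * c ≤ 1) (hα₃' : 40 * d * c ≤ 1 / 200)
    (hs₁ : 200 * C6 d * (2 * α₄) ≤ 1) (hs₂ : 12000 * ((d : ℝ) + 1) * L * (2 * α₄) ≤ 1)
    (hs₃ : C4G d L * (α₀ + 40 * d * c + 4 * (2 * α₄)) ≤ 1)
    (hs₄ : 1024 * ((d : ℝ) + 1) * ((d : ℝ) + 4) * L ^ 2 * α₀ ≤ 1) (hs₅ : 32 * ((d : ℝ) + 1) ^ 2 * C6 d * L ^ 2 * α₀ ≤ 1)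
    (hs₆ : 16 * d * C5' d * C6 d * (L : ℝ) ^ 2 * α₀ ≤ 1) (hs₇ : 8 * d * C6 d * L * α₀ ≤ 1)
    (hsm : 40 * d * c + α₄ ≤ 1 / (4 * B₀' * (2 * C2p d)))
    (s : lamSubK η U₀ L k Eb) (hp : (∀ (z : Site d) (i : Fin d), lamOf s (z + P • e i) = lamOf s z)) (hs : ‖s‖ ≤ α₄ / 4) :
    ∃ X : XSpace d k 𝔸, (∀ (p : Fin (k + 1) × Site d) (i : Fin d), X (p.1, p.2 + (P / (L : ℤ) ^ (p.1 : ℕ)) • e i) = X p) ∧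
      ‖X‖ ≤ α₄ / (2 * B₀') ∧ ‖X‖ ≤ C2p d * (40 * d * c + α₄) * α₄ ∧
      (∀ (j : ℕ) (hj : j ≤ k) (y : Site d), y ∉ Λs j → X (⟨j, Nat.lt_succ_of_le hj⟩, y) = 0) ∧
      (∀ (j : ℕ) (hj : j ≤ k) (y : Site d), y ∈ Λs j →
        Cnl L U₀ u₁⁻¹ j ((-I) • lamOf s - H' X) y = X (⟨j, Nat.lt_succ_of_le hj⟩, y)) ∧
      ∀ (j : ℕ), j ≤ k → ∀ y ∈ Λs j,
        Qnl L U₀ (fun x => expUnit (((-I) • lamOf s - H' X) x)) u₁⁻¹ j y =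
          QprimeIter (zdBlocking d L) (bgT L U₀) j ((-I) • lamOf s) y := by
  have hL1 : 1 ≤ L := le_trans (by norm_num) hL
  obtain ⟨h119b, h119a⟩ := ball_sub_119 (Λs := Λs) hL1 hη hα₄ hEbT s hs
  exact exists_Dprime_kLevel_inv_of_axial_per (Λ := Λs) (lam := (-I) • lamOf s) hd hL hL1 hU₀ hα hα3 hα4 hc hα₄ hB hαP hαP3 hαP2 hBu h33
    h69 hP hAx h129 h119b h119a hH0 (hH1_tower hL1 hη H' hEbT hH1) P hdiv hΛ hU₀per hu₁per
    (fun z i => by simp only [Pi.smul_apply, hp z i]) hHper hQH hsmall hc₃ hsc hα₃' hs₁ hs₂ hs₃ hs₄ hs₅ hs₆ hs₇ hsm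


end SectE

section Map

variable {L k : ℕ} {η : ℝ} {Λs : ℕ → Set (Site d)} {Eb : ℕ → Set (Site d × Fin d)} {U₀ : Site d → Fin d → 𝔸ˣ} {u₁ : Site d → 𝔸ˣ}

/-- ★ **THE MAP `λ ↦ D′(u₁⁻¹, −iλ)` ON THE PERIODIC CONFIGURATIONS OF THE ¼α₄-BALL, CHOSEN ONCE** — `B8Prop5JoinSectE.exists_Dprime_map` VERBATIM
with `hQH` at level-periodic families only, the torus data, every clause at PERIODIC `λ_s` (`λ_s, λ_t`), and `D′(λ_s)` level-periodic.
[cite: Balaban1985RegularSpaces, p.97 («We take D′(λ) equal to this solution»), (1.113)–(1.125) pp.95–97, (1.105)–(1.106) p.94, §3 p.98] -/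
theorem exists_Dprime_map_per (hL : 2 ≤ L) (hη : 0 < η) (hU₀ : ∀ x κ, U₀ x κ ∈ unitaryUnits 𝔸) (H' : XSpace d k 𝔸 →ₗ[ℂ] (Site d → 𝔸))
    {B : Site d → Fin d → 𝔸} {α₀ αP α₄ cB B₀' : ℝ}
    (hα : 0 < α₀) (hα3 : C0 d * α₀ ≤ 1 / 3) (hα4 : 4 * α₀ ≤ c2' d L) (hcB : 0 ≤ cB) (hα₄ : 0 < α₄) (hB : 0 < B₀')
    (h33 : ∀ j, j ≤ k → ∀ y ∈ Λs j, pdevOn (tlo L y j) (thi L y j) U₀ < α₀ * (((L : ℝ) ^ j)⁻¹) ^ 2)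
    (h69 : ∀ j, j ≤ k → ∀ y ∈ Λs j, ∀ (x : Site d) (κ : Fin d), InBox (tlo L y j) (thi L y j) x →
      InBox (tlo L y j) (thi L y j) (x + e κ) → ‖B x κ‖ ≤ cB * ((L : ℝ) ^ j)⁻¹)
    (hd : 1 ≤ d) (hαP : 0 < αP) (hαP3 : C0 d * αP ≤ 1 / 3) (hαP2 : 2 * αP ≤ c2' d L)
    (hBu : ∀ (x : Site d) (κ : Fin d), expCfg B x κ ∈ unitaryUnits 𝔸)
    (hP : ∀ j, j ≤ k → ∀ y ∈ Λs j, pdevOn (tlo L y j) (thi L y j) (expCfg B * U₀) < αP * (((L : ℝ) ^ j)⁻¹) ^ 2)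
    (hAx : InAx L k Λs U₀ (mgauge U₀ u₁ (expCfg B) * U₀)) (h129 : Restr129 L k Λs U₀ u₁)
    (hEbT : ∀ j, j ≤ k → ∀ y ∈ Λs j, ∀ (x : Site d) (κ : Fin d), InBox (tlo L y j) (thi L y j) x →
      InBox (tlo L y j) (thi L y j) (x + e κ) → (x, κ) ∈ Eb j)
    (hH0 : ∀ (X : XSpace d k 𝔸) (x : Site d), ‖H' X x‖ ≤ B₀' * ‖X‖)
    (hH1 : ∀ j, j ≤ k → ∀ (X : XSpace d k 𝔸), ∀ p ∈ Eb j, wt L η j * ‖covDerivFwd η U₀ p.2 (H' X) p.1‖ ≤ B₀' * ‖X‖)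
    (hHequiv : ∀ X Y : XSpace d k 𝔸, (∀ p, Y p = -star (X p)) → ∀ x, H' Y x = -star (H' X x))
    -- the torus: period `P` divisible by every `Lʲ`, shift-invariant `Λ_j`, periodic `U₀`, `u₁`, periodicity-preserving `H′`
    (P : ℤ) (hdiv : ∀ j, j ≤ k → ((L : ℤ) ^ j ∣ P))
    (hΛ : ∀ j, j ≤ k → ∀ (y : Site d) (i : Fin d), y + (P / (L : ℤ) ^ j) • e i ∈ Λs j ↔ y ∈ Λs j)
    (hU₀per : ∀ (z : Site d) (i : Fin d), U₀ (z + P • e i) = U₀ z) (hu₁per : ∀ (z : Site d) (i : Fin d), u₁ (z + P • e i) = u₁ z)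
    (hHper : ∀ X : XSpace d k 𝔸, (∀ (p : Fin (k + 1) × Site d) (i : Fin d), X (p.1, p.2 + (P / (L : ℤ) ^ (p.1 : ℕ)) • e i) = X p) →
      ∀ (z : Site d) (i : Fin d), H' X (z + P • e i) = H' X z)
    (hQH : ∀ (Y : XSpace d k 𝔸), (∀ (p : Fin (k + 1) × Site d) (i : Fin d), Y (p.1, p.2 + (P / (L : ℤ) ^ (p.1 : ℕ)) • e i) = Y p) →
      ∀ (j : ℕ) (hj : j ≤ k) (y : Site d), y ∈ Λs j →
      QprimeIter (zdBlocking d L) (bgT L U₀) j (H' Y) y = Y (⟨j, Nat.lt_succ_of_le hj⟩, y))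
    (hCequiv : ∀ j, j ≤ k → ∀ y ∈ Λs j, ∀ μ : Site d → 𝔸,
      (∀ x : Site d, InBox (tlo L y j) (thi L y j) x → ‖μ x‖ < α₄) →
      (∀ (x : Site d) (κ : Fin d), InBox (tlo L y j) (thi L y j) x → InBox (tlo L y j) (thi L y j) (x + e κ) →
        ‖cj (U₀ x κ) (μ (x + e κ)) - μ x‖ < α₄ * ((L : ℝ) ^ j)⁻¹) →
      Cnl L U₀ u₁⁻¹ j (fun x => -star (μ x)) y = -star (Cnl L U₀ u₁⁻¹ j μ y))
    (hsmall : Real.exp (4 * (800 * ((d : ℝ) + 1) ^ 2 * ((d : ℝ) + 4)) * α₀) * (1 + 8 * (131072 * ((d : ℝ) + 1) ^ 2) * cB) ≤ 2)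
    (hc₃ : 2 * cB ≤ c3 d L) (hsc : 2048 * (d : ℝ) * cB ≤ 1) (hα₃' : 40 * d * cB ≤ 1 / 200)
    (hs₁ : 200 * C6 d * (2 * α₄) ≤ 1) (hs₂ : 12000 * ((d : ℝ) + 1) * L * (2 * α₄) ≤ 1)
    (hs₃ : C4G d L * (α₀ + 40 * d * cB + 4 * (2 * α₄)) ≤ 1)
    (hs₄ : 1024 * ((d : ℝ) + 1) * ((d : ℝ) + 4) * L ^ 2 * α₀ ≤ 1) (hs₅ : 32 * ((d : ℝ) + 1) ^ 2 * C6 d * L ^ 2 * α₀ ≤ 1)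
    (hs₆ : 16 * d * C5' d * C6 d * (L : ℝ) ^ 2 * α₀ ≤ 1) (hs₇ : 8 * d * C6 d * L * α₀ ≤ 1)
    (hsm : 40 * d * cB + α₄ ≤ 1 / (4 * B₀' * (2 * C2p d))) :
    ∃ Dp : (Site d → 𝔸) → XSpace d k 𝔸,
      (∀ s : lamSubK η U₀ L k Eb, (∀ (z : Site d) (i : Fin d), lamOf s (z + P • e i) = lamOf s z) → ‖s‖ ≤ α₄ / 4 →
        (∀ (p : Fin (k + 1) × Site d) (i : Fin d), Dp (lamOf s) (p.1, p.2 + (P / (L : ℤ) ^ (p.1 : ℕ)) • e i) = Dp (lamOf s) p) ∧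
        ‖Dp (lamOf s)‖ ≤ α₄ / (2 * B₀') ∧ ‖Dp (lamOf s)‖ ≤ C2p d * (40 * d * cB + α₄) * α₄ ∧
        (∀ (j : ℕ) (hj : j ≤ k) (y : Site d), y ∉ Λs j → Dp (lamOf s) (⟨j, Nat.lt_succ_of_le hj⟩, y) = 0) ∧
        (∀ (j : ℕ) (hj : j ≤ k) (y : Site d), y ∈ Λs j →
          Cnl L U₀ u₁⁻¹ j ((-I) • lamOf s - H' (Dp (lamOf s))) y = Dp (lamOf s) (⟨j, Nat.lt_succ_of_le hj⟩, y)) ∧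
        ∀ (j : ℕ), j ≤ k → ∀ y ∈ Λs j,
          Qnl L U₀ (fun x => expUnit (((-I) • lamOf s - H' (Dp (lamOf s))) x)) u₁⁻¹ j y =
            QprimeIter (zdBlocking d L) (bgT L U₀) j ((-I) • lamOf s) y) ∧
      (∀ s t : lamSubK η U₀ L k Eb, (∀ (z : Site d) (i : Fin d), lamOf s (z + P • e i) = lamOf s z) → (∀ (z : Site d) (i : Fin d), lamOf t (z + P • e i) = lamOf t z) →
        ‖s‖ ≤ α₄ / 4 → ‖t‖ ≤ α₄ / 4 → ‖Dp (lamOf s) - Dp (lamOf t)‖ ≤ 4 * C2p d * (40 * d * cB + 2 * α₄) * ‖s - t‖) ∧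
      ∀ s : lamSubK η U₀ L k Eb, (∀ (z : Site d) (i : Fin d), lamOf s (z + P • e i) = lamOf s z) → ‖s‖ ≤ α₄ / 4 →
        (∀ x, IsSelfAdjoint (lamOf s x)) → ∀ p, star (Dp (lamOf s) p) = -Dp (lamOf s) p := by
  -- a solution with all the listed properties at each λ_s of the ball, chosen once
  have key : ∀ lam : Site d → 𝔸, ∃ X : XSpace d k 𝔸, ∀ s : lamSubK η U₀ L k Eb, lamOf s = lam → (∀ (z : Site d) (i : Fin d), lamOf s (z + P • e i) = lamOf s z) → ‖s‖ ≤ α₄ / 4 →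
      (∀ (p : Fin (k + 1) × Site d) (i : Fin d), X (p.1, p.2 + (P / (L : ℤ) ^ (p.1 : ℕ)) • e i) = X p) ∧
      ‖X‖ ≤ α₄ / (2 * B₀') ∧ ‖X‖ ≤ C2p d * (40 * d * cB + α₄) * α₄ ∧
      (∀ (j : ℕ) (hj : j ≤ k) (y : Site d), y ∉ Λs j → X (⟨j, Nat.lt_succ_of_le hj⟩, y) = 0) ∧
      (∀ (j : ℕ) (hj : j ≤ k) (y : Site d), y ∈ Λs j →
        Cnl L U₀ u₁⁻¹ j ((-I) • lamOf s - H' X) y = X (⟨j, Nat.lt_succ_of_le hj⟩, y)) ∧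
      ∀ (j : ℕ), j ≤ k → ∀ y ∈ Λs j,
        Qnl L U₀ (fun x => expUnit (((-I) • lamOf s - H' X) x)) u₁⁻¹ j y = QprimeIter (zdBlocking d L) (bgT L U₀) j ((-I) • lamOf s) y := by
    intro lam
    by_cases h : ∃ s : lamSubK η U₀ L k Eb, lamOf s = lam ∧ (∀ (z : Site d) (i : Fin d), lamOf s (z + P • e i) = lamOf s z) ∧ ‖s‖ ≤ α₄ / 4
    · obtain ⟨s, rfl, hp, hs⟩ := h
      obtain ⟨X, hX⟩ := sectE_exists_per hL hη hU₀ H' hα hα3 hα4 hcB hα₄ hB h33 h69 hd hαP hαP3 hαP2 hBu hP hAx h129 hEbT hH0 hH1 P hdiv hΛ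
        hU₀per hu₁per hHper hQH hsmall hc₃ hsc hα₃' hs₁ hs₂ hs₃ hs₄ hs₅ hs₆ hs₇ hsm s hp hs
      refine ⟨X, fun t ht _ _ => ?_⟩
      rw [B8LambdaSpaceKLevel.ext_of_lamOf ht]
      exact hX
    · exact ⟨0, fun s h1 h2 h3 => absurd ⟨s, h1, h2, h3⟩ h⟩
  choose Dp hDp' using key
  have hDp := fun (s : lamSubK η U₀ L k Eb) (hp : (∀ (z : Site d) (i : Fin d), lamOf s (z + P • e i) = lamOf s z)) (hs : ‖s‖ ≤ α₄ / 4) =>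
    hDp' (lamOf s) s rfl hp hs
  refine ⟨Dp, hDp, fun s t hps hpt hs ht => ?_, fun s hp hs hsa => ?_⟩
  · exact sectE_lipschitz hL hη hU₀ H' hα hα3 hα4 hcB hα₄ hB h33 h69 hd hαP hαP3 hαP2 hBu hP hAx h129 hEbT hH0 hH1 hsmall hc₃ hsc hα₃' hs₁ hs₂ hs₃ hs₄ hs₅
      hs₆ hs₇ hsm s t hs ht (hDp s hps hs).2.1 (hDp t hpt ht).2.1 (hDp s hps hs).2.2.2.1 (hDp s hps hs).2.2.2.2.1 (hDp t hpt ht).2.2.2.1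
      (hDp t hpt ht).2.2.2.2.1
  · exact sectE_real hL hη hU₀ H' hα hα3 hα4 hcB hα₄ hB h33 h69 hd hαP hαP3 hαP2 hBu hP hAx h129 hEbT hH0 hH1 hHequiv hCequiv hsmall hc₃ hsc hα₃' hs₁ hs₂ hs₃
      hs₄ hs₅ hs₆ hs₇ hsm s hs hsa (hDp s hp hs).2.1 (hDp s hp hs).2.2.2.1 (hDp s hp hs).2.2.2.2.1


end Map

#print axioms sectE_exists_per
#print axioms exists_Dprime_map_per

end Literature.MathematicalPhysics.QuantumFieldTheory.Balaban1983to89.B8Prop5JoinSectEPer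

end
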